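import Summits.ABC.IUTFork.Thm311RealIsmDHMoverCriterion
import Literature.IUT.LogVolume.UnitLogDyadicOddRamification
import HarnessLib

/-!
# [IUTchIII] Cor. 3.12, TEAM R `indFixes` thread: over `2`, at ODD ramification index `e(v|2) ≥ 3`,
# Dupuy–Hilado's (Ind2) MOVES EVERY BALL

PROOF-ONLY file (0 definitions, 0 named facts) of the abc-iut cell (block C / W6 prover seat abc-iut-w6-d060,
gen 2; TEAM R «ismDH mover» record support); TAKES NO SIDE on [IUTchIII] Cor. 3.12.  Dyadic companion of
`Thm311RealIsmDHMoverDeep`: abc-iut-w5-d180's BALL-MOVER CRITERION (p432150) composed with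
`Literature/IUT/LogVolume/UnitLogDyadicOddRamification` (this seat: for `e` odd `≥ 3` over `ℚ_2`, `log_2(𝒪^×)` meets
the sphere `‖z‖ = ‖ϖ‖`, so — by abc-iut-w5-d039's volume constraint with `m ≥ 1` — no ball is `2^k·log_2(𝒪^×)`).

RESULT `exists_mem_ismDH_image_closedBall_ne_of_odd_ramificationIdx_two`: at a place `v | 2` of a number field with
`e(v|2)` ODD and `≥ 3`, for EVERY `t ≠ 0` some element of `Real.ismDH logv (inr v)` moves `{‖y‖ ≤ ‖t‖}` — no
hypothesis on `f(v|2)` or roots of unity.  (Even `e` over `2`: abc-iut-w5-d039's dyadic census — the unit ball is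
fixed exactly in the shapes `(e, f, m) = (2,1,1), (2,2,2), (4,1,3)`; `e = 1`: abc-iut-w5-d180 / w5-d216.)

HONEST FRAMING as in the companion files: a statement about Dupuy–Hilado's typed (Ind2) on one-factor hull-sets;
nothing about [IUTchIII] Cor. 3.12.  [cite: DupuyHilado2025, §4.9] [cite: WeilBNT1967, Ch. II §2, Th. 1–2]
[cite: NeukirchANT1999, Ch. II Prop. (5.5)–(5.7)] [claim: Mochizuki2012, status: disputed] for every [IUTchIII] locution.
-/

noncomputable section

open Metric Set NumberField IsDedekindDomain
open scoped Pointwise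

namespace Summit.ABC.IUTFork.Thm311.Real

open Cor312Vol Literature.IUT.LogThetaLattice Literature.IUT.LogVolume Literature.NumberTheory.NumberFields
open Literature.NumberTheory.GaloisRepresentations.Ultrametric

variable {F : Type} [Field F] [NumberField F] [h2 : Fact (Nat.Prime 2)]
variable {logv : PadicLogs F} (hlog : LogvAnalyticAt 2 logv)
variable {v : HeightOneSpectrum (𝓞 F)} {hv : ((2 : ℕ) : 𝓞 F) ∈ v.asIdeal}
include hlog

/-- **DYADIC ODD-RAMIFICATION MOVER.** At a place `v | 2` with `e(v|2)` odd and `≥ 3`, for EVERY `t ≠ 0` some element of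
Dupuy–Hilado's (Ind2) group `Real.ismDH logv (inr v)` moves the ball `t·𝒪_v`. [cite: DupuyHilado2025, §4.9]
[cite: WeilBNT1967, Ch. II §2, Th. 1–2] [cite: NeukirchANT1999, Ch. II Prop. (5.5)–(5.7)] -/
theorem exists_mem_ismDH_image_closedBall_ne_of_odd_ramificationIdx_two (hodd : Odd (v.asIdeal.ramificationIdx ℤ))
    (he : 3 ≤ v.asIdeal.ramificationIdx ℤ) {t : RescaledCompletion F 2 v hv} (ht : t ≠ 0) :
    ∃ g ∈ ismDH logv (.inr v),
      (fun a => toR 2 v hv (g (ofR 2 v hv a))) '' closedBall (0 : RescaledCompletion F 2 v hv) ‖t‖ ≠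
        closedBall 0 ‖t‖ := by
  obtain ⟨ϖ, hϖ, -⟩ := exists_isUniformizer_rescaledCompletion F 2 v hv
  have heK := absRamificationIdx_rescaledCompletion F 2 v hv
  have hodd' : Odd (absRamificationIdx 2 (RescaledCompletion F 2 v hv)) := by rw [heK]; exact hodd
  have he' : 3 ≤ absRamificationIdx 2 (RescaledCompletion F 2 v hv) := by rw [heK]; exact he
  exact exists_mem_ismDH_image_closedBall_ne_of_forall_ne hlog v hv ht fun k =>
    DyadicOddRamification.closedBall_norm_ne_zpow_smul_logUnits_of_odd hϖ hodd' he' ht k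

/-- The unit ball in particular: at `v | 2` with `e(v|2)` odd `≥ 3`, `𝒪_v` is moved by some (Ind2)-element (a case of
abc-iut-w5-d039's census `exists_mem_ismDH_image_closedBall_one_ne_of_two`). [cite: DupuyHilado2025, §4.9] -/
theorem exists_mem_ismDH_image_closedBall_one_ne_of_odd_ramificationIdx_two
    (hodd : Odd (v.asIdeal.ramificationIdx ℤ)) (he : 3 ≤ v.asIdeal.ramificationIdx ℤ) :
    ∃ g ∈ ismDH logv (.inr v),
      (fun a => toR 2 v hv (g (ofR 2 v hv a))) '' closedBall (0 : RescaledCompletion F 2 v hv) 1 ≠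
        closedBall 0 1 := by
  have h := exists_mem_ismDH_image_closedBall_ne_of_odd_ramificationIdx_two hlog hodd he
    (one_ne_zero : (1 : RescaledCompletion F 2 v hv) ≠ 0)
  rwa [norm_one] at h

end Summit.ABC.IUTFork.Thm311.Real

end

-- tree-health (abc-iut-w6-d081 g4, 2026-08-26T13:50Z): comment-only re-land of a STRANDED ACCEPT (module accepted, not importable on the farm for > 100 min, two serial import probes hung);
-- declarations byte-identical to the accepted version; purpose = trigger the rebuild (w4-d014 10:34:09Z remedy class). No content change.
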